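import Summits.ValiantsHypothesis.ValiantsHypothesis.Theorems.KPlusLogSqLawTropicalPermutationChanges
import Summits.ValiantsHypothesis.ValiantsHypothesis.Theorems.KPlusLogSqLawTropicalBSplitDefs

/-!
# `TropicalB` — the SHARP class-switch budget: excess multiplicity of the support

HONEST FRAMING.  Helper toward the crux `Summit.ValiantsHypothesis.ValiantsHypothesis.Theses.KPlusLogSqLaw.TropicalB`
(ledger item `stmt-ValiantsHypothesis-19771`, route `KPlusLogSqLaw`, regime stubs `stub_tropThin` / `stub_tropFat` of
`Cruxes/TropicalB/Lines/birth.lean`; object-search cell `pub-symmetroid`, prover seat val-sym-trop-p3, 2026-08-26).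
Sharpens the class-switch budget `…TropicalPermutationChanges.card_samePerm_steps_le` (val-sym-lift-p2, p419330: at most
`m²(K−1)` steps of a dominant chain keep the permutation) to a SUPPORT-SENSITIVE form, in the tree's vocabulary:

* `card_samePerm_steps_le_excess` — along a sign-alternating dominant chain of ANY design `(d, v, ε)` of format `(m, K)`,
  the number of steps `k → k+1` with `σₖ = σₖ₊₁` is at most the EXCESS MULTIPLICITY of the support,
  `Σ_{entries (i,j)} (#{l : ε i j l ≠ 0} − 1)` (an entry carrying `c ≥ 1` present classes contributes `c − 1`, a dead
  entry `0`).  Proof: the key-maximal present class of every entry (the entry profile of the static reduction) moves to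
  strictly larger exponents along the chain, hence its rank AMONG THE PRESENT CLASSES OF ITS ENTRY strictly increases
  when it changes; a dominant term uses the profile class at each of its entries, so a step with a common permutation
  raises the total present-rank potential, which is bounded by the excess multiplicity.
* `chain_le_permChanges_add_excess` — hence `n ≤ P + excess`, `P` = number of permutation-CHANGING steps;
  `excess_le_card_mul` (excess ≤ m²·(K−1), recovering lift-p2's budget) and `excess_eq_zero_of_static` (static designs:
  excess `0`, every step changes the permutation).

Reading (no claim beyond the theorems): sparse supports pay class switching only on their support — Hessenberg / DAG
walk matrices (val-sym-trop-p5's sector) on their `O(#edges)` live entries, a support inside two permutation matrices on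
`2m` entries; everything else in a long chain is permutation turnover.  Nothing here bounds `T(m, K)` in the window
`log₂ m + 1 < K < m`; nothing bears on `TropicalB`, `KPlusLogSqLaw`, `MatrixDescartes` or `VP ≠ VNP`.

[folklore] potential bookkeeping; profile construction adapted from `…TropicalKLawStatic` (`tropRootLawAt_of_static`,
p410710) and `…TropicalPermutationChanges` (p419330).
-/

-- `Summit.ValiantsHypothesis.ValiantsHypothesis.…` repeats a component by the D-0017 layout (single-conjunct summit),
-- which the `dupNamespace` linter flags; the namespace is mandated (same as the sibling `…TropicalKLaw*` modules).
set_option linter.dupNamespace false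
set_option autoImplicit false

namespace Summit.ValiantsHypothesis.ValiantsHypothesis.Theorems.LacunarySymmetroidMatrixDescartes.TropicalCensus

open Summit.ValiantsHypothesis.ValiantsHypothesis.Theorems.MatrixDescartes.Negative
open scoped BigOperators
open Finset

variable {m K : ℕ}

/-- the excess multiplicity of a support is at most `m·m·(K−1)`. [folklore] -/
theorem excess_le_card_mul (ε : Fin m → Fin m → Fin K → ℤ) :
    ∑ e : Fin m × Fin m, ((univ.filter fun l => ε e.1 e.2 l ≠ 0).card - 1) ≤ m * m * (K - 1) := by
  calc ∑ e : Fin m × Fin m, ((univ.filter fun l => ε e.1 e.2 l ≠ 0).card - 1)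
      ≤ ∑ _e : Fin m × Fin m, (K - 1) := by
        refine sum_le_sum fun e _ => Nat.sub_le_sub_right ?_ 1
        calc (univ.filter fun l => ε e.1 e.2 l ≠ 0).card ≤ (univ : Finset (Fin K)).card := card_filter_le _ _
          _ = K := by rw [card_univ, Fintype.card_fin]
    _ = m * m * (K - 1) := by rw [sum_const, card_univ, Fintype.card_prod, Fintype.card_fin, smul_eq_mul]

/-- a static design (one present class per entry) has excess multiplicity `0`. [folklore] -/
theorem excess_eq_zero_of_static (ε : Fin m → Fin m → Fin K → ℤ) (hst : IsStatic ε) :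
    ∑ e : Fin m × Fin m, ((univ.filter fun l => ε e.1 e.2 l ≠ 0).card - 1) = 0 := by
  refine sum_eq_zero fun e _ => ?_
  have h1 : (univ.filter fun l => ε e.1 e.2 l ≠ 0).card ≤ 1 := by
    rw [card_le_one]
    intro a ha b hb
    rw [mem_filter] at ha hb
    exact hst e.1 e.2 a b ha.2 hb.2
  omega


/-- **The sharp class-switch budget.**  Along a sign-alternating dominant chain of an arbitrary design of format
`(m, K)`, the steps `k → k+1` with a common permutation `σₖ = σₖ₊₁` number at most the excess multiplicity
`Σ_{(i,j)} (#{l : ε i j l ≠ 0} − 1)` of the support. [folklore] -/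
theorem card_samePerm_steps_le_excess (d : Fin K → ℕ) (v ε : Fin m → Fin m → Fin K → ℤ) {n : ℕ}
    (θ : Fin (n + 1) → ℤ) (p : Fin (n + 1) → Equiv.Perm (Fin m) × (Fin m → Fin K))
    (hθ : StrictMono θ) (hdom : ∀ k, IsDominant d v ε (θ k) (p k))
    (halt : ∀ k : Fin n, termSign ε (p k.castSucc) * termSign ε (p k.succ) < 0) :
    (univ.filter fun k : Fin n => (p k.castSucc).1 = (p k.succ).1).card ≤
      ∑ e : Fin m × Fin m, ((univ.filter fun l => ε e.1 e.2 l ≠ 0).card - 1) := by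
  classical
  rcases Nat.eq_zero_or_pos K with hK | hK
  · -- no class: the chain is a single term
    subst hK
    have hn : n ≤ 0 := tropRootLawAt_zero m 0 d v ε n θ p (fun i j l => l.elim0) hθ hdom halt
    obtain rfl : n = 0 := Nat.le_zero.mp hn
    simp
  set l₀ : Fin K := ⟨0, hK⟩ with hl₀
  -- present classes of an entry
  set P : Fin m → Fin m → Finset (Fin K) := fun i j => univ.filter fun l => ε i j l ≠ 0 with hP
  have hmemP : ∀ i j l, l ∈ P i j ↔ ε i j l ≠ 0 := by intro i j l; simp [hP]
  -- the key-maximal present class (junk `l₀` on dead entries)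
  have hex : ∀ (k : Fin (n + 1)) (i j : Fin m), ∃ l : Fin K,
      ((P i j).Nonempty → (l ∈ P i j ∧ ∀ l' ∈ P i j, key d v (θ k) i j l' ≤ key d v (θ k) i j l)) ∧
      (¬ (P i j).Nonempty → l = l₀) := by
    intro k i j
    by_cases hne : (P i j).Nonempty
    · obtain ⟨l, hl, hmax⟩ := exists_max_image (P i j) (key d v (θ k) i j) hne
      exact ⟨l, fun _ => ⟨hl, hmax⟩, fun hh => absurd hne hh⟩
    · exact ⟨l₀, fun hh => absurd hh hne, fun _ => rfl⟩
  choose Λ hΛ using hex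
  -- F1: a dominant term uses the profile class at each of its entries
  have hF1 : ∀ (k : Fin (n + 1)) (i : Fin m), (p k).2 i = Λ k ((p k).1 i) i := by
    intro k i
    have hpres : ε ((p k).1 i) i ((p k).2 i) ≠ 0 := present_of_termSign_ne_zero ε (p k) (hdom k).1 i
    have hne : (P ((p k).1 i) i).Nonempty := ⟨(p k).2 i, (hmemP _ _ _).mpr hpres⟩
    obtain ⟨hΛmem, hΛmax⟩ := (hΛ k ((p k).1 i) i).1 hne
    by_contra hcon
    have hΛpres : ε ((p k).1 i) i (Λ k ((p k).1 i) i) ≠ 0 := (hmemP _ _ _).mp hΛmem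
    have hdk : IsDominant d v ε (θ k) ((p k).1, (p k).2) := hdom k
    have hs := score_lt_of_dominant d v ε (θ k) (p k).1 (p k).2 hdk i (Λ k ((p k).1 i) i) hΛpres
      (fun hh => hcon hh.symm)
    have hm := hΛmax ((p k).2 i) ((hmemP _ _ _).mpr hpres)
    unfold key at hm
    have hl : (((p k).2 i : ℕ) : ℤ) < K := by exact_mod_cast ((p k).2 i).isLt
    have h0 : (0 : ℤ) ≤ ((Λ k ((p k).1 i) i : ℕ) : ℤ) := by positivity
    have hint : θ k * (d (Λ k ((p k).1 i) i) : ℤ) - v ((p k).1 i) i (Λ k ((p k).1 i) i) + 1 ≤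
        θ k * (d ((p k).2 i) : ℤ) - v ((p k).1 i) i ((p k).2 i) := hs
    nlinarith
  -- F2: the profile moves to weakly larger exponents, strictly when it changes
  have hF2 : ∀ (k k' : Fin (n + 1)), k < k' → ∀ i j, d (Λ k i j) ≤ d (Λ k' i j) ∧
      (Λ k i j ≠ Λ k' i j → d (Λ k i j) < d (Λ k' i j)) := by
    intro k k' hkk' i j
    by_cases hne : (P i j).Nonempty
    · obtain ⟨h1mem, h1max⟩ := (hΛ k i j).1 hne
      obtain ⟨h2mem, h2max⟩ := (hΛ k' i j).1 hne
      suffices hsuff : Λ k i j ≠ Λ k' i j → d (Λ k i j) < d (Λ k' i j) by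
        refine ⟨?_, hsuff⟩
        by_cases hq : Λ k i j = Λ k' i j
        · rw [hq]
        · exact (hsuff hq).le
      intro hneq
      have ha : key d v (θ k) i j (Λ k' i j) < key d v (θ k) i j (Λ k i j) :=
        lt_of_le_of_ne (h1max _ h2mem) (fun hh => hneq (key_injective d v (θ k) i j hh).symm)
      have hb : key d v (θ k') i j (Λ k i j) < key d v (θ k') i j (Λ k' i j) :=
        lt_of_le_of_ne (h2max _ h1mem) (fun hh => hneq (key_injective d v (θ k') i j hh))
      unfold key at ha hb
      have hθkk' : θ k < θ k' := hθ hkk'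
      have hKpos : (0 : ℤ) < (K : ℤ) + 1 := by positivity
      set D := (d (Λ k' i j) : ℤ) - (d (Λ k i j) : ℤ) with hD
      have hsum : ((K : ℤ) + 1) * ((θ k' - θ k) * D) > 0 := by nlinarith
      have hD' : (θ k' - θ k) * D > 0 := by
        by_contra hcon
        push Not at hcon
        have := mul_nonpos_of_nonneg_of_nonpos hKpos.le hcon
        linarith
      have hDpos : D > 0 := by
        by_contra hcon
        push Not at hcon
        have := mul_nonpos_of_nonneg_of_nonpos (by linarith : (0 : ℤ) ≤ θ k' - θ k) hcon
        linarith
      exact_mod_cast (sub_pos.mp hDpos)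
    · rw [(hΛ k i j).2 hne, (hΛ k' i j).2 hne]
      exact ⟨le_rfl, fun hh => absurd rfl hh⟩
  -- present rank of a class at an entry: number of PRESENT classes of strictly smaller exponent
  set prank : Fin m → Fin m → Fin K → ℕ :=
    fun i j l => ((P i j).filter fun l' => d l' < d l).card with hprank
  have hprank_mono : ∀ i j (l l' : Fin K), d l ≤ d l' → prank i j l ≤ prank i j l' := by
    intro i j l l' h
    simp only [hprank]
    exact card_le_card (fun x hx => by
      rw [mem_filter] at hx ⊢; exact ⟨hx.1, lt_of_lt_of_le hx.2 h⟩)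
  have hprank_lt : ∀ i j (l l' : Fin K), l ∈ P i j → d l < d l' → prank i j l < prank i j l' := by
    intro i j l l' hl h
    simp only [hprank]
    apply card_lt_card
    rw [ssubset_iff_of_subset (fun x hx => by rw [mem_filter] at hx ⊢; exact ⟨hx.1, hx.2.trans h⟩)]
    exact ⟨l, by rw [mem_filter]; exact ⟨hl, h⟩, fun hh => by rw [mem_filter] at hh; exact lt_irrefl _ hh.2⟩
  have hΛrank_le : ∀ k i j, prank i j (Λ k i j) ≤ (P i j).card - 1 := by
    intro k i j
    by_cases hne : (P i j).Nonempty
    · have hl : Λ k i j ∈ P i j := ((hΛ k i j).1 hne).1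
      have hsub : ((P i j).filter fun l' => d l' < d (Λ k i j)) ⊆ (P i j).erase (Λ k i j) := by
        intro x hx
        rw [mem_filter] at hx
        rw [mem_erase]
        exact ⟨fun h => lt_irrefl _ (h ▸ hx.2), hx.1⟩
      calc prank i j (Λ k i j) ≤ ((P i j).erase (Λ k i j)).card := card_le_card hsub
        _ = (P i j).card - 1 := card_erase_of_mem hl
    · rw [not_nonempty_iff_eq_empty] at hne
      simp [hprank, hne]
  -- the potential
  set Φ : Fin (n + 1) → ℕ := fun k => ∑ e : Fin m × Fin m, prank e.1 e.2 (Λ k e.1 e.2) with hΦ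
  have hΦle : ∀ k, Φ k ≤ ∑ e : Fin m × Fin m, ((univ.filter fun l => ε e.1 e.2 l ≠ 0).card - 1) := by
    intro k
    exact sum_le_sum fun e _ => hΛrank_le k e.1 e.2
  have hΦmono : ∀ k k' : Fin (n + 1), k ≤ k' → Φ k ≤ Φ k' := by
    intro k k' hkk'
    rcases hkk'.lt_or_eq with hlt | heq
    · exact sum_le_sum fun e _ => hprank_mono e.1 e.2 _ _ (hF2 k k' hlt e.1 e.2).1
    · rw [heq]
  -- a step with a common permutation raises the potential strictly
  have hstep : ∀ k : Fin n, (p k.castSucc).1 = (p k.succ).1 → Φ k.castSucc < Φ k.succ := by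
    intro k hσ
    have hlt : k.castSucc < k.succ := Fin.castSucc_lt_succ
    have hne : p k.castSucc ≠ p k.succ := KPlusLogSqLaw.ne_succ_of_alternating ε p halt k
    have h2 : (p k.castSucc).2 ≠ (p k.succ).2 := fun h => hne (Prod.ext hσ h)
    obtain ⟨i, hi⟩ := Function.ne_iff.mp h2
    set σ := (p k.castSucc).1 with hσdef
    have hΛne : Λ k.castSucc (σ i) i ≠ Λ k.succ (σ i) i := by
      intro hh
      apply hi
      rw [hF1 k.castSucc i, hF1 k.succ i, ← hσdef, ← hσ]
      exact hh
    have hpresΛ : Λ k.castSucc (σ i) i ∈ P (σ i) i := by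
      rw [hmemP, ← hF1 k.castSucc i]
      exact present_of_termSign_ne_zero ε (p k.castSucc) (hdom _).1 i
    have hstrict : prank (σ i) i (Λ k.castSucc (σ i) i) < prank (σ i) i (Λ k.succ (σ i) i) :=
      hprank_lt (σ i) i _ _ hpresΛ ((hF2 _ _ hlt (σ i) i).2 hΛne)
    exact sum_lt_sum (fun e _ => hprank_mono e.1 e.2 _ _ (hF2 _ _ hlt e.1 e.2).1) ⟨(σ i, i), mem_univ _, hstrict⟩
  -- counting: `k ↦ Φ (k.castSucc)` is injective on the same-permutation steps, with values below the excess
  set S := univ.filter fun k : Fin n => (p k.castSucc).1 = (p k.succ).1 with hSdef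
  have hmaps : ∀ k ∈ S, Φ k.castSucc ∈
      range (∑ e : Fin m × Fin m, ((univ.filter fun l => ε e.1 e.2 l ≠ 0).card - 1)) := by
    intro k hk
    rw [hSdef, mem_filter] at hk
    rw [mem_range]
    exact lt_of_lt_of_le (hstep k hk.2) (hΦle _)
  have hinjOn : Set.InjOn (fun k : Fin n => Φ k.castSucc) S := by
    intro k hk k' hk' hkk'
    rw [hSdef, coe_filter] at hk hk'
    by_contra hne
    rcases lt_or_gt_of_ne hne with hlt | hlt
    · have h1 := hstep k hk.2
      have h2 : Φ k.succ ≤ Φ k'.castSucc := hΦmono _ _ (by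
        rw [Fin.le_iff_val_le_val, Fin.val_succ, Fin.val_castSucc]; exact hlt)
      simp only at hkk'
      omega
    · have h1 := hstep k' hk'.2
      have h2 : Φ k'.succ ≤ Φ k.castSucc := hΦmono _ _ (by
        rw [Fin.le_iff_val_le_val, Fin.val_succ, Fin.val_castSucc]; exact hlt)
      simp only at hkk'
      omega
  calc S.card ≤ (range (∑ e : Fin m × Fin m, ((univ.filter fun l => ε e.1 e.2 l ≠ 0).card - 1))).card :=
        card_le_card_of_injOn _ hmaps hinjOn
    _ = _ := card_range _

/-- **`n ≤ P + excess`**: the length of a sign-alternating dominant chain is at most the number `P` of its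
permutation-changing steps plus the excess multiplicity of the support. [folklore] -/
theorem chain_le_permChanges_add_excess (d : Fin K → ℕ) (v ε : Fin m → Fin m → Fin K → ℤ) {n : ℕ}
    (θ : Fin (n + 1) → ℤ) (p : Fin (n + 1) → Equiv.Perm (Fin m) × (Fin m → Fin K))
    (hθ : StrictMono θ) (hdom : ∀ k, IsDominant d v ε (θ k) (p k))
    (halt : ∀ k : Fin n, termSign ε (p k.castSucc) * termSign ε (p k.succ) < 0) :
    n ≤ (univ.filter fun k : Fin n => (p k.castSucc).1 ≠ (p k.succ).1).card +
      ∑ e : Fin m × Fin m, ((univ.filter fun l => ε e.1 e.2 l ≠ 0).card - 1) := by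
  have hsplit := card_filter_add_card_filter_not
    (s := (univ : Finset (Fin n))) (fun k : Fin n => (p k.castSucc).1 = (p k.succ).1)
  have hS := card_samePerm_steps_le_excess d v ε θ p hθ hdom halt
  rw [card_univ, Fintype.card_fin] at hsplit
  simp only [ne_eq] at hS hsplit ⊢
  omega

end Summit.ValiantsHypothesis.ValiantsHypothesis.Theorems.LacunarySymmetroidMatrixDescartes.TropicalCensus
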